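import Mathlib
import HarnessLib
import Summits.QuantumFields.YangMills.Theorems.ComplexCouplingChannelContinuumLegGivenGapAlternatingArraysDefs

/-!
# `ContinuumLegGivenGap` (stmt-QuantumFields-15828), line `alternating-curvature-arrays`: `stub_productToUniform`, helper P3 — the grid-offset selection (pigeonhole) and the core geometry of a shifted grid

Support file for the Whitney / grid-shift / nuclear step `stub_productToUniform` ((PB) ⇒ (UUVB)) of the line
`alternating-curvature-arrays` (triage S2 GRID SHIFTS).  The product bound (PB) = `ProductBound r sch` only reaches
tensor test functions supported in the CORES of the cells of ONE translated grid (offset `v ∈ ℤ⁴`, level `m`, cell side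
`cellSide m = 3^m/2` lattice units, core = cell shrunk by two lattice units).  The cores of one grid do not cover space, so
the Whitney step uses `(2p+1)^4` lattice offsets `v = j • d`, `j ∈ {0,…,2p}^4`, with a step `d` satisfying
`(2p+1) d ≤ 3^m/2`; this file proves that they suffice:

* §1 `offsets_good_offset_real` — ONE AXIS: for `p` reals `tᵢ`, a period `P` and a step `d > 0` with `(2p+1) d ≤ P`,
  some `j ≤ 2p` keeps every `tᵢ` at distance `≥ d/2` from the shifted lattice `j d + P ℤ` (each `tᵢ` spoils at most ONE
  of the `2p+1` candidate offsets: two spoilt offsets would differ by `< d` modulo `P`, impossible for distinct multiples of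
  `d` below `P − d`); `offsets_good_offset` — FOUR AXES at once (registered anchor of this file);
* §2 the geometry of the chosen grid in the language of the landed Defs
  (`Theorems/ComplexCouplingChannelContinuumLegGivenGapAlternatingArraysDefs.lean`): the home-cell index
  `⌊(t − v)/P⌋`, the wall-distance criterion for membership in a physical core
  (`offsets_mem_physCore_of_wallDist`), distinct cells for points more than a cell side apart
  (`offsets_cellIdx_ne_of_lt_dist`), and the central-half-box criterion (`offsets_cellInHalfBox_of_abs_le`).

Pure arithmetic (floors, pigeonhole); no measure theory.  [folklore]
-/

set_option autoImplicit false

noncomputable section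

namespace Summit.QuantumFields.YangMills.Theorems.ContinuumLegGivenGap

open Summit.QuantumFields.YangMills.Theorems.ContinuumLegGivenGap.AlternatingArrays

/-! ## §1 Offset selection -/

/-- Two offsets spoilt by the same point coincide: if `|t − (j d + n P)| < d/2` and `|t − (j' d + n' P)| < d/2` with
`j, j' ≤ 2p` and `(2p+1) d ≤ P`, then `j = j'`. [folklore] -/
theorem offsets_spoilt_unique {p : ℕ} {t P d : ℝ} (hd : 0 < d) (hP : (2 * p + 1 : ℝ) * d ≤ P)
    {j j' : ℕ} (hj : j ≤ 2 * p) (hj' : j' ≤ 2 * p) {n n' : ℤ}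
    (h : |t - ((j : ℝ) * d + (n : ℝ) * P)| < d / 2) (h' : |t - ((j' : ℝ) * d + (n' : ℝ) * P)| < d / 2) : j = j' := by
  -- the two shifted lattice points are `< d` apart
  have hdiff : |((j : ℝ) - j') * d + ((n : ℝ) - n') * P| < d := by
    have h1 := abs_sub_lt_iff.1 h
    have h2 := abs_sub_lt_iff.1 h'
    rw [abs_lt]
    constructor <;> nlinarith
  have hP0 : 0 < P := lt_of_lt_of_le (by positivity) hP
  by_cases hn : n = n'
  · -- same period: `|j - j'| d < d`
    subst hn
    have h1 : |((j : ℝ) - j')| * d < d := by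
      rw [sub_self, zero_mul, add_zero, abs_mul, abs_of_pos hd] at hdiff
      exact hdiff
    have h2 : |((j : ℝ) - j')| < 1 := by
      by_contra hc
      push Not at hc
      have : d ≤ |((j : ℝ) - j')| * d := by nlinarith
      linarith
    have h3 : |((j : ℤ) - j')| < 1 := by
      have : (|((j : ℤ) - j')| : ℝ) < 1 := by push_cast; exact h2
      exact_mod_cast this
    have h4 : (j : ℤ) = j' := by
      rcases abs_lt.1 h3 with ⟨h5, h6⟩
      omega
    exact_mod_cast h4
  · -- different periods: the `P`-part is `≥ P ≥ (2p+1) d` while the `d`-part is `≤ 2p d`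
    exfalso
    have hnn : (1 : ℝ) ≤ |((n : ℝ) - n')| := by
      have h1 : (1 : ℤ) ≤ |(n : ℤ) - n'| := by
        rcases lt_or_gt_of_ne hn with hlt | hlt
        · rw [abs_of_neg (by omega)]; omega
        · rw [abs_of_pos (by omega)]; omega
      have : ((1 : ℤ) : ℝ) ≤ ((|(n : ℤ) - n'| : ℤ) : ℝ) := by exact_mod_cast h1
      simpa using this
    have hjj : |((j : ℝ) - j')| ≤ 2 * p := by
      rw [abs_le]
      have h1 : (j : ℝ) ≤ 2 * p := by exact_mod_cast hj
      have h2 : (j' : ℝ) ≤ 2 * p := by exact_mod_cast hj'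
      have h3 : (0 : ℝ) ≤ j := Nat.cast_nonneg _
      have h4 : (0 : ℝ) ≤ j' := Nat.cast_nonneg _
      constructor <;> linarith
    -- `|A + B| ≥ |B| - |A|`
    have key : |((n : ℝ) - n') * P| - |((j : ℝ) - j') * d| ≤ |((j : ℝ) - j') * d + ((n : ℝ) - n') * P| := by
      have := abs_sub_abs_le_abs_sub (((n : ℝ) - n') * P) (-(((j : ℝ) - j') * d))
      rw [abs_neg, sub_neg_eq_add, add_comm] at this
      exact this
    have hB : P ≤ |((n : ℝ) - n') * P| := by
      rw [abs_mul, abs_of_pos hP0]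
      nlinarith
    have hA : |((j : ℝ) - j') * d| ≤ 2 * p * d := by
      rw [abs_mul, abs_of_pos hd]
      nlinarith
    nlinarith

/-- **Offset selection, one axis.** For `p` reals `tᵢ`, a period `P` and a step `d > 0` with `(2p+1) d ≤ P`, one of the
`2p+1` offsets `j d`, `j ≤ 2p`, keeps every `tᵢ` at distance `≥ d/2` from the shifted lattice `j d + P ℤ`. [folklore] -/
theorem offsets_good_offset_real {p : ℕ} (t : Fin p → ℝ) {P d : ℝ} (hd : 0 < d) (hP : (2 * p + 1 : ℝ) * d ≤ P) :
    ∃ j : Fin (2 * p + 1), ∀ (i : Fin p) (n : ℤ), d / 2 ≤ |t i - (((j : ℕ) : ℝ) * d + (n : ℝ) * P)| := by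
  classical
  -- the offsets spoilt by the point `i`
  let bad : Fin p → Finset (Fin (2 * p + 1)) := fun i =>
    Finset.univ.filter fun j => ∃ n : ℤ, |t i - (((j : ℕ) : ℝ) * d + (n : ℝ) * P)| < d / 2
  have hcard : ∀ i, (bad i).card ≤ 1 := fun i => by
    refine Finset.card_le_one.2 fun j hj j' hj' => ?_
    simp only [bad, Finset.mem_filter, Finset.mem_univ, true_and] at hj hj'
    obtain ⟨n, hn⟩ := hj
    obtain ⟨n', hn'⟩ := hj'
    exact Fin.ext (offsets_spoilt_unique hd hP (by omega) (by omega) hn hn')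
  -- fewer than `2p+1` offsets are spoilt in total
  have hunion : (Finset.univ.biUnion bad).card < (Finset.univ : Finset (Fin (2 * p + 1))).card := by
    calc (Finset.univ.biUnion bad).card ≤ ∑ i, (bad i).card := Finset.card_biUnion_le
      _ ≤ ∑ _i : Fin p, 1 := Finset.sum_le_sum fun i _ => hcard i
      _ = p := by simp
      _ < (Finset.univ : Finset (Fin (2 * p + 1))).card := by simp; omega
  obtain ⟨j, -, hj⟩ := Finset.exists_mem_notMem_of_card_lt_card hunion
  refine ⟨j, fun i n => ?_⟩
  by_contra hlt
  push Not at hlt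
  exact hj (Finset.mem_biUnion.2 ⟨i, Finset.mem_univ _, by
    simp only [bad, Finset.mem_filter, Finset.mem_univ, true_and]; exact ⟨n, hlt⟩⟩)

/-- **Offset selection, four axes** (registered anchor).  For `p` points `xᵢ ∈ ℝ⁴`, a period `P` and a step `d > 0`
with `(2p+1) d ≤ P`, some multi-offset `j ∈ {0,…,2p}^4` keeps every coordinate `xᵢ^μ` at distance `≥ d/2` from the
shifted lattice `j_μ d + P ℤ` — i.e. all `p` points lie `≥ d/2` inside the cells of the grid of period `P` translated by
`(j_μ d)_μ`, in every axis. [folklore] -/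
theorem offsets_good_offset : ∀ (p : ℕ) (x : Fin p → Fin 4 → ℝ) (P d : ℝ), 0 < d → (2 * p + 1 : ℝ) * d ≤ P →
    ∃ j : Fin 4 → Fin (2 * p + 1), ∀ (i : Fin p) (μ : Fin 4) (n : ℤ),
      d / 2 ≤ |x i μ - (((j μ : ℕ) : ℝ) * d + (n : ℝ) * P)| := by
  intro p x P d hd hP
  have h := fun μ : Fin 4 => offsets_good_offset_real (fun i => x i μ) hd hP
  choose j hj using h
  exact ⟨j, fun i μ n => hj μ i n⟩

/-! ## §2 Geometry of the chosen grid -/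

/-- The cell of its index contains the point: `v + P z ≤ t < v + P (z+1)`, `z = ⌊(t − v)/P⌋`. [folklore] -/
theorem offsets_cellIdx_mem {P : ℝ} (hP : 0 < P) (v t : ℝ) :
    v + P * (⌊(t - v) / P⌋ : ℝ) ≤ t ∧ t < v + P * ((⌊(t - v) / P⌋ : ℝ) + 1) := by
  have h1 : ((⌊(t - v) / P⌋ : ℤ) : ℝ) ≤ (t - v) / P := Int.floor_le _
  have h2 : (t - v) / P < ((⌊(t - v) / P⌋ : ℤ) : ℝ) + 1 := Int.lt_floor_add_one _
  rw [le_div_iff₀ hP] at h1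
  rw [div_lt_iff₀ hP] at h2
  constructor <;> nlinarith

/-- **Wall distance ⇒ depth.** If `t` is at distance `≥ δ` from every wall `v + P n`, `n ∈ ℤ`, then it lies `≥ δ`
inside its own cell: `v + P z + δ ≤ t ≤ v + P (z+1) − δ`. [folklore] -/
theorem offsets_depth_of_wallDist {P : ℝ} (hP : 0 < P) {v t δ : ℝ}
    (h : ∀ n : ℤ, δ ≤ |t - (v + (n : ℝ) * P)|) :
    v + P * (⌊(t - v) / P⌋ : ℝ) + δ ≤ t ∧ t ≤ v + P * ((⌊(t - v) / P⌋ : ℝ) + 1) - δ := by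
  obtain ⟨h1, h2⟩ := offsets_cellIdx_mem hP v t
  set z : ℤ := ⌊(t - v) / P⌋ with hz
  constructor
  · have h3 := h z
    rw [abs_of_nonneg (by nlinarith)] at h3
    nlinarith
  · have h3 := h (z + 1)
    rw [abs_of_nonpos (by push_cast; nlinarith)] at h3
    push_cast at h3
    nlinarith

/-- **Membership in a physical core from wall distances.** At spacing `a > 0`, level `m`, integer offset `v`: a
physical point `y` whose lattice coordinates `y_μ / a` are all at distance `≥ δ ≥ 2` from the walls
`v_μ + (3^m/2) ℤ` lies in the core `physCore a m v z` of its home cell `z_μ = ⌊(y_μ/a − v_μ)/(3^m/2)⌋`. [folklore] -/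
theorem offsets_mem_physCore_of_wallDist {a : ℝ} (ha : 0 < a) (m : ℕ) (v : Fin 4 → ℤ)
    (y : EuclideanSpace ℝ (Fin 4)) {δ : ℝ} (hδ : 2 ≤ δ)
    (h : ∀ (μ : Fin 4) (n : ℤ), δ ≤ |y μ / a - ((v μ : ℝ) + (n : ℝ) * cellSide m)|) :
    y ∈ physCore a m v (fun μ => ⌊(y μ / a - v μ) / cellSide m⌋) := by
  have hP : 0 < cellSide m := by unfold cellSide; positivity
  intro μ
  obtain ⟨h1, h2⟩ := offsets_depth_of_wallDist hP (v := (v μ : ℝ)) (t := y μ / a) (δ := δ) (h μ)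
  have hy : y μ = a * (y μ / a) := by field_simp
  constructor
  · rw [hy]
    refine mul_le_mul_of_nonneg_left ?_ ha.le
    linarith
  · rw [hy]
    refine mul_le_mul_of_nonneg_left ?_ ha.le
    linarith

/-- **Distinct points far apart have distinct home cells.** If `|t − t'| > P` then the cell indices differ.
[folklore] -/
theorem offsets_cellIdx_ne_of_lt_dist {P : ℝ} (hP : 0 < P) (v : ℝ) {t t' : ℝ} (h : P < |t - t'|) :
    ⌊(t - v) / P⌋ ≠ ⌊(t' - v) / P⌋ := by
  intro heq
  obtain ⟨h1, h2⟩ := offsets_cellIdx_mem hP v t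
  obtain ⟨h3, h4⟩ := offsets_cellIdx_mem hP v t'
  rw [heq] at h1 h2
  have : |t - t'| < P := by rw [abs_lt]; constructor <;> nlinarith
  linarith

/-- Multi-point version: if two of the `p` points differ by more than a cell side in SOME axis (in lattice units),
their home cells (computed axis by axis) differ; hence pairwise sup-separation `> P` makes the home-cell map
injective. [folklore] -/
theorem offsets_cellIdx_injective {p : ℕ} {P : ℝ} (hP : 0 < P) (v : Fin 4 → ℝ) (t : Fin p → Fin 4 → ℝ)
    (h : ∀ i i', i ≠ i' → ∃ μ, P < |t i μ - t i' μ|) :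
    Function.Injective fun i => fun μ => ⌊(t i μ - v μ) / P⌋ := by
  intro i i' hii'
  by_contra hne
  obtain ⟨μ, hμ⟩ := h i i' hne
  exact offsets_cellIdx_ne_of_lt_dist hP (v μ) hμ (congrFun hii' μ)

/-- **Central half-box criterion.** If every lattice coordinate satisfies `|y_μ/a| + 3^m/2 ≤ L/2`, the home cell of
`y` lies in the central half-box `[-L/2, L/2]^4` (no torus seam is met). [folklore] -/
theorem offsets_cellInHalfBox_of_abs_le (a : ℝ) (L m : ℕ) (v : Fin 4 → ℤ)
    (y : EuclideanSpace ℝ (Fin 4)) (h : ∀ μ, |y μ / a| + cellSide m ≤ (L : ℝ) / 2) :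
    CellInHalfBox L m v (fun μ => ⌊(y μ / a - v μ) / cellSide m⌋) := by
  have hP : 0 < cellSide m := by unfold cellSide; positivity
  intro μ
  obtain ⟨h1, h2⟩ := offsets_cellIdx_mem hP (v μ : ℝ) (y μ / a)
  have h3 := abs_le.1 (le_of_add_le_of_nonneg_left (h μ) hP.le)
  have hμ := h μ
  constructor
  · -- lower wall `≥ t - P ≥ -L/2`
    nlinarith [abs_le.1 (show |y μ / a| ≤ (L : ℝ) / 2 - cellSide m by linarith)]
  · nlinarith [abs_le.1 (show |y μ / a| ≤ (L : ℝ) / 2 - cellSide m by linarith)]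

end Summit.QuantumFields.YangMills.Theorems.ContinuumLegGivenGap

end
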